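import Summits.BirchSwinnertonDyer.BirchSwinnertonDyer.Theses.SignedLowerHalves
import Summits.BirchSwinnertonDyer.BirchSwinnertonDyer.Theorems.SignedLowerHalvesKobayashiMainConjectureSmallImageAcnsCrux
import Summits.BirchSwinnertonDyer.BirchSwinnertonDyer.Theorems.SignedLowerHalvesKobayashiMainConjectureSmallImageAcanchorGlueRatRatNotCMCoprime
import Summits.BirchSwinnertonDyer.BirchSwinnertonDyer.Theorems.SignedLowerHalvesKobayashiMainConjectureSmallImagePublishedInputsNsOfFiveOfMazur
import Summits.BirchSwinnertonDyer.BirchSwinnertonDyer.Theorems.SignedLowerHalvesKobayashiLowerHalfLargeImageHorocycleMuFloor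
import Summits.BirchSwinnertonDyer.BirchSwinnertonDyer.Theorems.SignedLowerHalvesKobayashiLowerHalfLargeImageSignDefectX7
import HarnessLib

/-!
# Line `birth_acns` v15-w2 PROPOSAL (width seat `bsd-line-slh-p3-w2` g0, 2026-08-29) — child L `SmallImageLowerHalfBothSigns`
# (item stmt-BirchSwinnertonDyer-23599): v14 with THE SIGN MADE IDLE — the BOTH-signs analytic `μ`-rider `stub_muBothSigns_ns`
# (Perrin-Riou Conj. 6.1.1 / Pollack 2003 Conj. 6.3 on the residually `K`-dihedral class, OPEN in print) is REPLACED by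
# (i) the ONE-sign rider at `5 ≤ p` = retired item 23117 `SmallImageOneSignUnitContent` VERBATIM (`stub_muOneSign_ns_ge5`; itself a
# consequence of Conjecture B⁰ `TeichSpanGenAll` with NO image hypothesis, `LargeImageMuFloor.signedMuFloor_of_teichSpanGenAll`) and
# (ii) one more HELD construction fact, Kobayashi's JOINT Coleman–Kato package `Kobayashi2003.thm62_63_73_signedColemanKato_zetaJoint`
# (`stub_jointZeta_ns`, ACCEPTED Literature named fact, already in the route's cone through crux 19001's line `commonzero_squeeze`);
# at `p = 3` NO `μ`-rider is left at all (the one free sign is the tree's input-free `LargeImageMuFloor.signedMuFloor_three`).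
# WHY THIS IS ENOUGH: on class X7 at an odd `p` with `a_p = 0` the sign of the Eisenstein half is IDLE —
# `SignDefect.X7.exists_kobayashiLowerDivisibility_iff_forall` (slh-p1 LEAD g4; Kobayashi Thm. 7.4's proof: both four-term sequences start
# at the same `𝐇¹/Z`, so `char X^ε ⊆ (L_p^ε)` for one `ε` is Kato's Eisenstein inclusion `char X₀ ⊆ char(𝐇¹/Z)`, which is sign-free) —
# so the line needs the INTEGRAL lower half at ONE sign per pair (rational engines + `μ(L_p^{ε₀}) = 0` at the sign `ε₀` where it is
# free / B⁰ / certified), and the other sign follows.  (= the vet's KEY n1 on 23599, g0 22:25Z / g1 22:53Z, executed.)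
# Stubs: 7 = `stub_ES2rat_ns`, `stub_acDivRat_ns`, `stub_publishedInputs_ns`, `stub_preprintInputs_ns`, `stub_lambdaLowerThree_ns`
# (all five VERBATIM v14 = registered 1f0ed6fd7ed827ce), `stub_muOneSign_ns_ge5` (= v13's stub / 23117 verbatim), `stub_jointZeta_ns` (NEW, HELD
# cite-only).  Composition `SmallImageLowerHalfBothSigns_of` concludes child L BY NAME; sorries only in the 7 stubs.  NOT registered by this
# seat (the LEAD owns the skeleton, L1); filed as `Lines/birth_acns_v15w2.lean` + evidence for the LEAD's decision.  BSD / child L NOT proved.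

## v14 header (LEAD slh-p3 g14), kept verbatim below for the history

# Line `birth_acns` v14 — RE-REGISTERED on child L `SmallImageLowerHalfBothSigns` (route SignedLowerHalves, crux rank 401;
# item stmt-BirchSwinnertonDyer-23599) of the `μ`-resplit (K3 rev 18, turnkey #6 GO 6a, 2026-08-28T21:58Z) of crux 4
# `KobayashiMainConjectureSmallImage` (stmt-19002): v13's composition MINUS ITS KATO/`μ` TAIL (saturation ⇒ equality), its conclusion
# now the INTEGRAL Eisenstein half for BOTH signs — so its `μ`-rider is RE-CUT from ONE sign to BOTH signs (lead seat bsd-line-slh-p3 gen 14)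

History v2–v13 (crux 4, `Cruxes/KobayashiMainConjectureSmallImage/Lines/birth_acns.lean`, sha16 8959f4935fd86146): see that file's header;
its six stubs were items 23115–23119 of K3 rev 17 (engines split), RETIRED UNREFUTED by rev 18 and returned here as stubs.

v14 − v13 (this file).  The parent crux asked for `∃ ε, KobayashiMainConjecture W p ε`; child L asks for
`∀ ε, KobayashiLowerDivisibility W p ε` — the INTEGRAL lower half at EVERY sign, with no Kato side.  In v13 the engines T2_rat / T1_rat
are RATIONAL (what Euler / Kolyvagin systems give at non-surjective image), the package T3 they generate yields the cyclotomic signed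
lower divisibility at every sign `ε` only UP TO A POWER OF `p` (`SmallImageAcnsDescent.rationalLowerDivisibility_of_package_noSurj`), and
integrality AT THE SIGN `ε` came from `μ(L_p^ε) = 0` at that sign (`SmallImageAcnsCrux.kobayashiLowerDivisibility_of_package_of_signed_hasUnitContent_noSurj`:
`p` is prime in `Λ`).  v13 therefore needed the analytic `μ`-rider for ONE sign (`stub_muOneSign_ns_ge5`, + the PROVED input-free `p = 3`
one-sign rider p643729) and concluded at that sign.  Child L needs integrality at BOTH signs, hence (honest re-cut, D-0014 — the only change
of substance):

* `stub_muBothSigns_ns` (NEW, replaces `stub_muOneSign_ns_ge5` = retired 23117 `SmallImageOneSignUnitContent`): at every pair of the domain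
  and EVERY odd `p` (including `3`), for the conductor-level newform `f` and EACH sign `ε`, some `L₀` with `IsSignedPAdicLFunction f p ε L₀ ∧
  HasUnitContent L₀` — i.e. `μ(L_p⁺) = μ(L_p⁻) = 0`, Perrin-Riou's conjecture in full on the residually `K`-dihedral class
  [Pollack 2003 Conj. 6.3; Pollack–Weston 2011 Rem. 4.2]; OPEN for either sign separately; at `p = 3` the tree proves `min(μ⁺, μ⁻) = 0`
  input-free (p643729), so the residual there is the OTHER sign.  (The weaker exact need is `μ(X^ε) ≥ μ(L_p^ε)` at each sign.)
* the Kato/`μ` tail is GONE: `thm62_63_73_signedColemanKato_zeta` (1st bundle, 3rd conjunct of `stub_publishedInputs_ns`) is now IDLE —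
  kept verbatim so the HELD text stays the vetted one (the pen may trim it when itemising); Kobayashi Thm 4.1 `h41` is still consumed by
  the `5 ≤ p` descent's signature.
* `stub_ES2rat_ns`, `stub_acDivRat_ns` (engines, = retired 23115 / 23116), `stub_publishedInputs_ns` ∧ `stub_preprintInputs_ns` (= retired
  23119), `stub_lambdaLowerThree_ns` (= retired 23118, ALREADY both signs) are VERBATIM v13.

Composition `SmallImageLowerHalfBothSigns_of` (no sorry of its own): at `5 ≤ p`, `lowerGeFive_of_stubs` = T3 (`canonical_ns_of_stubs`, v13
verbatim) + the rider AT THE GIVEN SIGN through `SmallImageAcnsCrux.kobayashiLowerDivisibility_of_package_of_signed_hasUnitContent_noSurj`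
(p621671); at `p = 3`, `lowerThree_of_stubs` = the `p`-inverted λ-part at the given sign (`stub_lambdaLowerThree_ns`) + the rider at that
sign (Pollack-pair currency by uniqueness `IsSignedPAdicLFunction.unique`) + the period unit (`HorocycleMuDoor.periodUnit_of_named_facts` from
`h5`/`h3`) through w2's door `HorocycleMuDoor.kobayashiLowerDivisibility_of_pInverted_of_hasUnitContent` (p647721); odd `p` is `3` or `≥ 5`.
Conclusion BY NAME: `Theses.SignedLowerHalves.SmallImageLowerHalfBothSigns`.  Stubs: 6 (two engines on `p ∤ h_K`; the BOTH-signs analytic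
`μ`-rider; two cite bundles HELD / PRE; the `p = 3` λ-part).  Sibling child M (`SmallImageMuZeroOneSign`, 23600, algebraic `μ = 0` for one
sign) and the glue 23602 (PROVED, `Theorems/…SmallImageOfMuParts.lean`) are NOT used here.

HONEST: child L, crux 4 and BSD are OPEN / not proved by this seat; nothing here asserts the PRE binders, the held facts (incl. BRR 2022
Thm. 1) or the `μ`-rider.  READING FOR THE PEN (D-0014): as typed (BOTH signs, integral), L costs this line a BOTH-signs `μ`-statement that the
parent crux did not need (one sign sufficed); the variant «L∃: `∃ ε`, lower half at SOME sign» is what v13 minus its tail gives VERBATIM with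
the old one-sign rider — but then the glue needs M at THE SAME sign (6a′: M∀).  Either way one both-signs `μ`-statement sits in the cone.
-/

set_option autoImplicit false
set_option linter.dupNamespace false

noncomputable section

open scoped Classical MatrixGroups ModularForm

namespace Summit.BirchSwinnertonDyer.BirchSwinnertonDyer.Cruxes.SmallImageLowerHalfBothSigns.BirthAcns

open CongruenceSubgroup Literature.NumberTheory.EllipticCurves Literature.NumberTheory.EllipticCurves.Rank1Residual
  Literature.NumberTheory.EllipticCurves.ModularForms Literature.NumberTheory.EllipticCurves.Kobayashi2003
  Literature.NumberTheory.EllipticCurves.GreenbergVatsal2000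
  Literature.NumberTheory.EllipticCurves.BurungaleSkinnerTianWan2024
  Literature.NumberTheory.EllipticCurves.BurungaleCastellaSkinner2025
  Summit.BirchSwinnertonDyer.Rank1Residual.Supersingular

/-- stub T2_rat¬CM,h of «acns» (v13 = v5's T2_rat¬CM with the binder `¬ p ∣ NumberField.classNumber K →` after `κ₂.IsAnticyclotomic →` — the 20727-coprime shape; v5 = v3's T2_rat with the binder `¬ W.HasCM →` added — the CM leak of the `Surj ↦ ¬Surj` swap closed; the RATIONAL two-variable Euler-system inclusion `∃ a, (p^a·G) ⊆ ch(X_Gr₂(E/K̃_∞))^{ur}`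
on the small-image supersingular domain — VERBATIM line `ratlift`'s `stub_ratEulerSystemSS` of crux stmt-20728 (route
SignedBaseChange) with the binder `Surj W p →` replaced by `¬ Surj W p →` and the `SignedTwoVariableInputs →` prefix
replaced by the parametrisation fact (as v2's T2); = v2's `stub_ES2_ns` with exactly the `μ`-part forgotten. What
two-variable Euler-system machinery yields WITHOUT the big-image/`τ` hypothesis (Rubin Thm. 2.3.3); integrality is
recovered in the composition by RATIONAL RIGIDITY (`…SmallImageRationalRigidity`, gen 6) from T1 + BCS25 Prop. 4.2.2.
PRE-adjacent (signed Beilinson–Flach classes at `a_p = 0`: BSTW 2024 / Büyükboduk–Lei), not in print as stated. -/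
theorem stub_ES2rat_ns : Literature.NumberTheory.EllipticCurves.ModularForms.nonempty_modularParametrizationData → ∀ (W : WeierstrassCurve ℚ) [W.IsElliptic] [W.IsGloballyMinimal] (p : ℕ) [Fact p.Prime], 5 ≤ p → W.HasGoodReductionAtPrime p → W.frobeniusTrace p = 0 → ¬ Literature.NumberTheory.EllipticCurves.Rank1Residual.Surj W p → ¬ W.HasCM → ∀ (K : Type) [Field K] [NumberField K] (ι : PadicAlgCl p ≃+* ℂ) (v vbar : IsDedekindDomain.HeightOneSpectrum (NumberField.RingOfIntegers K)) (κ₁ κ₂ : ZpExtension K p) (γ₁ γ₂ : Field.absoluteGaloisGroup K) [Fact (ZpExtension.IsTopGeneratorPair κ₁ κ₂ γ₁ γ₂)] [NeZero (NumberField.discr K).natAbs] (N : ℕ) [NeZero N] (f : CuspForm (CongruenceSubgroup.Gamma0 N) 2), IsNewformOf W f → (N : ℤ) = W.conductorNorm ℤ → IsImaginaryQuadratic K → ((Ideal.span {(p : ℤ)}).primesOver (NumberField.RingOfIntegers K)).ncard = 2 → ((p : ℕ) : NumberField.RingOfIntegers K) ∈ v.asIdeal → ((p : ℕ) : NumberField.RingOfIntegers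 K) ∈ vbar.asIdeal → vbar ≠ v → (∀ (w : NumberField.InfinitePlace K) (k : NumberField.RingOfIntegers K), k ∈ v.asIdeal ↔ ‖ι.symm (w.embedding (k : K))‖ < 1) → IsCoprime (N : ℤ) (NumberField.discr K) → (∀ ℓ : ℕ, ℓ.Prime → ℓ ∣ N → ((Ideal.span {(ℓ : ℤ)}).primesOver (NumberField.RingOfIntegers K)).ncard = 2) → Odd (NumberField.discr K) → NumberField.discr K ≠ -3 → κ₁.IsCyclotomic → κ₂.IsAnticyclotomic → ¬ p ∣ NumberField.classNumber K → ∀ (Ω δ : ℂ) (Ωp : (unrIntegers p)ˣ) (LK G : PowerSeries (PowerSeries (PadicComplexInt p))), Ω ≠ 0 → (δ ^ 2 = (NumberField.discr K : ℂ) ∨ δ ^ 2 = -(NumberField.discr K : ℂ)) → IsKatzMeasure₂ ι v vbar ∅ κ₁ κ₂ γ₁⁻¹ γ₂⁻¹ 1 Ω δ ((Ωp : unrIntegers p) : PadicComplex p) LK → IsGreenbergLFunctionAnyRoot₂ ι v vbar κ₁ κ₂ γ₁⁻¹ γ₂⁻¹ f (NumberField.discr K).natAbs (NumberField.classNumber K)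 LK G → ∀ J : ℤ_[p] →+* PadicComplexInt p, (∀ x : ℤ_[p], ((J x : PadicComplexInt p) : PadicComplex p) = ((x : ℚ_[p]) : PadicComplex p)) → ∃ a : ℕ, Ideal.span {((p : ℕ) : PowerSeries (PowerSeries (PadicComplexInt p))) ^ a * G} ≤ (WeierstrassCurve.XGr₂.charIdeal (W.baseChange K) p κ₁ κ₂ vbar γ₁ γ₂).map (IwasawaAlgebra₂.toUnr₂ p J) := by
  sorry

/-- stub T1_rat¬CM,h of «acns» (v13 = v5's T1_rat¬CM with the binder `¬ p ∣ NumberField.classNumber K →` after `κ₂.IsAnticyclotomic →` — the 20727-coprime shape, the cell on which the printed anticyclotomic ± theory runs; v5 = v4's T1_rat with the binder `¬ W.HasCM →` added — the CM leak of the `Surj ↦ ¬Surj` swap closed; the RATIONAL anticyclotomic Eisenstein inclusion on `T₁ = 0`: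
`∃ b, (p^b)·ch^{ur}|_{T₁=0} ⊆ (G⁻)` — VERBATIM the acanchor stub ACdiv / item stmt-20727's body with the binder swap
`Surj W p →` ↦ `W.frobeniusTrace p = 0 → ¬ Surj W p →` and the conclusion multiplied by `(p^b)`; = v2/v3's
`stub_acDiv_ns` with exactly the `μ`-part forgotten. Engine L1 = Howard's Λ-adic Heegner-point Kolyvagin bound run
at supersingular prime-to-`p` image (its error terms bounded, not zero ⇒ a `p^b`) + the BDP-side Eisenstein inclusion
(line `bdpline` of crux 20727, S1-rat); the `p^b` is cancelled in the composition by SATURATION of `(G⁻)` under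
constants (`…SmallImageRationalAnchor`, gen 6, after the ideator's `RatAnchorSaturation.lean`) from BCS25 Prop.
4.2.2. OPEN / PRE-adjacent. -/
theorem stub_acDivRat_ns : Literature.NumberTheory.EllipticCurves.ModularForms.nonempty_modularParametrizationData → ∀ (W : WeierstrassCurve ℚ) [W.IsElliptic] [W.IsGloballyMinimal] (p : ℕ) [Fact p.Prime], 5 ≤ p → W.HasGoodReductionAtPrime p → W.frobeniusTrace p = 0 → ¬ Literature.NumberTheory.EllipticCurves.Rank1Residual.Surj W p → ¬ W.HasCM → ∀ (K : Type) [Field K] [NumberField K] (ι : PadicAlgCl p ≃+* ℂ) (v vbar : IsDedekindDomain.HeightOneSpectrum (NumberField.RingOfIntegers K)) (κ₁ κ₂ : ZpExtension K p) (γ₁ γ₂ : Field.absoluteGaloisGroup K) [Fact (ZpExtension.IsTopGeneratorPair κ₁ κ₂ γ₁ γ₂)] [NeZero (NumberField.discr K).natAbs] (N : ℕ) [NeZero N] (f : CuspForm (CongruenceSubgroup.Gamma0 N) 2), IsNewformOf W f → (N : ℤ) = W.conductorNorm ℤ → IsImaginaryQuadratic K → ((Ideal.span {(p : ℤ)}).primesOver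 (NumberField.RingOfIntegers K)).ncard = 2 → ((p : ℕ) : NumberField.RingOfIntegers K) ∈ v.asIdeal → ((p : ℕ) : NumberField.RingOfIntegers K) ∈ vbar.asIdeal → vbar ≠ v → (∀ (w : NumberField.InfinitePlace K) (k : NumberField.RingOfIntegers K), k ∈ v.asIdeal ↔ ‖ι.symm (w.embedding (k : K))‖ < 1) → IsCoprime (N : ℤ) (NumberField.discr K) → (∀ ℓ : ℕ, ℓ.Prime → ℓ ∣ N → ((Ideal.span {(ℓ : ℤ)}).primesOver (NumberField.RingOfIntegers K)).ncard = 2) → Odd (NumberField.discr K) → NumberField.discr K ≠ -3 → κ₁.IsCyclotomic → κ₂.IsAnticyclotomic → ¬ p ∣ NumberField.classNumber K → ∀ (Ω δ : ℂ) (Ωp : (unrIntegers p)ˣ) (LK G : PowerSeries (PowerSeries (PadicComplexInt p))), Ω ≠ 0 → (δ ^ 2 = (NumberField.discr K : ℂ) ∨ δ ^ 2 = -(NumberField.discr K : ℂ)) → IsKatzMeasure₂ ι v vbar ∅ κ₁ κ₂ γ₁⁻¹ γ₂⁻¹ 1 Ω δ ((Ωp : unrIntegers p) : PadicComplex p) LK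 → IsGreenbergLFunctionAnyRoot₂ ι v vbar κ₁ κ₂ γ₁⁻¹ γ₂⁻¹ f (NumberField.discr K).natAbs (NumberField.classNumber K) LK G → ∀ J : ℤ_[p] →+* PadicComplexInt p, (∀ x : ℤ_[p], ((J x : PadicComplexInt p) : PadicComplex p) = ((x : ℚ_[p]) : PadicComplex p)) → ∃ b : ℕ, Ideal.span {((p : ℕ) : PowerSeries (PadicComplexInt p)) ^ b} * ((WeierstrassCurve.XGr₂.charIdeal (W.baseChange K) p κ₁ κ₂ vbar γ₁ γ₂).map (IwasawaAlgebra₂.toUnr₂ p J)).map (PowerSeries.constantCoeff (R := PowerSeries (PadicComplexInt p))) ≤ Ideal.span {UnrSeries₂.minus G} := by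
  sorry

/-- stub (HELD, cite-only — PUBLISHED named facts / one reviewed construction fact, none with `_holds`; v11 re-cut = the INPUTS desk's
five prints ∧ Mazur 1978 Cor. 4.1; v13: ∧ Beckwith–Raum–Richter 2022 Thm. 1): Kobayashi Thm 4.1, Thm 1.2, the Coleman–Kato ζ construction fact
(Thm 6.2/6.3/7.3), modularity with parametrisation, BCS 2025 Prop 4.2.2; Mazur's `p ∤ c_Manin` for odd `p` (from which the period units at
`p ≥ 5` and `p = 3` follow, p640631); and the Hurwitz-class-number indivisibility `BRR2022_thm_1` (Adv. Math. 409 (2022), Thm. 1), which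
supplies the v13 frame's Heegner field with `p ∤ h_K` (`SmallImageAcanchorGlueRatRatNotCMCoprime.frameData_canonical_noSurj_coprimeClassNumber`). -/
theorem stub_publishedInputs_ns :
    (Literature.NumberTheory.EllipticCurves.Kobayashi2003.thm41_signedCharIdeal_divisibility ∧
      Literature.NumberTheory.EllipticCurves.Kobayashi2003.thm12_signedSelmerDual_finite_torsion ∧
      Literature.NumberTheory.EllipticCurves.Kobayashi2003.thm62_63_73_signedColemanKato_zeta ∧
      Literature.NumberTheory.EllipticCurves.ModularForms.nonempty_modularParametrizationData ∧
      Literature.NumberTheory.EllipticCurves.BurungaleCastellaSkinner2025.prop422_greenbergAnyRoot_hasUnitContent_minus) ∧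
    Literature.NumberTheory.EllipticCurves.ModularForms.mazur_not_dvd_maninConstant_of_odd ∧
    Literature.NumberTheory.QuadraticFields.BRR2022_thm_1 := by
  sorry

/-- **T3 (`CanonicalNs`, the K1″-shaped package on the crux's domain) DERIVED from T1_rat¬CM,h ∧ T2_rat¬CM,h** by the landed glue
`SmallImageAcanchorGlueRatRatNotCMCoprime.canonicalNs_of_eulerSystemRatNotCMCoprime_of_acDivRatNotCMCoprime_noSurj` (v13; v5–v12 used
`SmallImageAcanchorGlueRatRatNotCM.canonicalNs_of_eulerSystemRatNotCM_of_acDivRatNotCM_noSurj`) (frame supply WITH `p ∤ h_K` granted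
Beckwith–Raum–Richter 2022 Thm. 1 = the 3rd conjunct of `stub_publishedInputs_ns` + rational anchor + saturation + RATIONAL rigidity,
image clauses from Matar–Nekovář; ACμ⁺ `μ(G⁻) = 0` from BCS Prop 4.2.2 = first conjunct of the inputs). No sorry of its own. -/
theorem canonical_ns_of_stubs :
    (Literature.NumberTheory.EllipticCurves.BurungaleCastellaSkinner2025.prop422_greenbergAnyRoot_hasUnitContent_minus ∧ Literature.NumberTheory.EllipticCurves.BurungaleSkinnerTianWan2024.props118_27_519_exists_signedTwoVariablePackage_supersingular_PRE) → Literature.NumberTheory.EllipticCurves.ModularForms.nonempty_modularParametrizationData → ∀ (W : WeierstrassCurve ℚ) [W.IsElliptic] [W.IsGloballyMinimal] (p : ℕ) [Fact p.Prime], 5 ≤ p → Literature.NumberTheory.EllipticCurves.Rank1Residual.ClassX7 W p → ¬ W.HasCM → W.frobeniusTrace p = 0 → ¬ Literature.NumberTheory.EllipticCurves.Rank1Residual.Surj W p → ∃ (K : Type) (_ : Field K) (_ : NumberField K) (ι : PadicAlgCl p ≃+* ℂ) (v vbar : IsDedekindDomain.HeightOneSpectrum (NumberField.RingOfIntegers K))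 (κ₁ κ₂ : Literature.NumberTheory.EllipticCurves.ZpExtension K p) (γ₁ γ₂ : Field.absoluteGaloisGroup K) (_ : Fact (Literature.NumberTheory.EllipticCurves.ZpExtension.IsTopGeneratorPair κ₁ κ₂ γ₁ γ₂)) (_ : NeZero (NumberField.discr K).natAbs) (N : ℕ) (_ : NeZero N) (f : CuspForm (CongruenceSubgroup.Gamma0 N) 2) (d : ℤ) (W' : WeierstrassCurve ℚ) (_ : W'.IsElliptic) (_ : W'.IsGloballyMinimal) (C : WeierstrassCurve.VariableChange ℚ) (N' : ℕ) (_ : NeZero N') (f' : CuspForm (CongruenceSubgroup.Gamma0 N') 2), Literature.NumberTheory.EllipticCurves.ModularForms.IsNewformOf W f ∧ (N : ℤ) = W.conductorNorm ℤ ∧ Literature.NumberTheory.EllipticCurves.ModularForms.IsNewformOf W' f' ∧ (N' : ℤ) = W'.conductorNorm ℤ ∧ Squarefree d ∧ 1 < d ∧ (∀ q : ℕ, q.Prime → Literature.NumberTheory.EllipticCurves.BurungaleSkinnerTianWan2024.RamifiedInQuadratic d q → q ≠ p ∧ ¬ q ∣ N ∧ ¬ (q : ℤ) ∣ NumberField.discr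 K) ∧ C • W' = W.quadraticTwist (d : ℚ) ∧ Literature.NumberTheory.EllipticCurves.IsImaginaryQuadratic K ∧ ((Ideal.span {(p : ℤ)}).primesOver (NumberField.RingOfIntegers K)).ncard = 2 ∧ ((p : ℕ) : NumberField.RingOfIntegers K) ∈ v.asIdeal ∧ ((p : ℕ) : NumberField.RingOfIntegers K) ∈ vbar.asIdeal ∧ vbar ≠ v ∧ (∀ (w : NumberField.InfinitePlace K) (k : NumberField.RingOfIntegers K), k ∈ v.asIdeal ↔ ‖ι.symm (w.embedding (k : K))‖ < 1) ∧ IsCoprime (N : ℤ) (NumberField.discr K) ∧ (∀ ℓ : ℕ, ℓ.Prime → ℓ ∣ N → ((Ideal.span {(ℓ : ℤ)}).primesOver (NumberField.RingOfIntegers K)).ncard = 2) ∧ (∀ ℓ : ℕ, ℓ.Prime → (ℓ : ℤ) ∣ d → ((Ideal.span {(ℓ : ℤ)}).primesOver (NumberField.RingOfIntegers K)).ncard = 2) ∧ ((Ideal.span {(2 : ℤ)}).primesOver (NumberField.RingOfIntegers K)).ncard = 2 ∧ (∀ ρ : Literature.NumberTheory.GaloisRepresentations.ModPGaloisRep K (ZMod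 p) 2, (W.baseChange K).IsTorsionGaloisRep p ρ → Literature.NumberTheory.GaloisRepresentations.FramedRep.IsAbsolutelyIrreducible ρ) ∧ κ₁.IsCyclotomic ∧ κ₂.IsAnticyclotomic ∧ (∃ ζ : ℤ_[p]ˣ, IsOfFinOrder ζ ∧ ((Literature.NumberTheory.GaloisRepresentations.GaloisRep.cyclotomicCharacter K p γ₁ * ζ : ℤ_[p]ˣ) : ℤ_[p]) = (Literature.NumberTheory.EllipticCurves.cyclotomicGenerator p : ℤ_[p])) ∧ ∀ (Ω δ : ℂ) (Ωp : (Literature.NumberTheory.EllipticCurves.unrIntegers p)ˣ) (LK G G' : PowerSeries (PowerSeries (PadicComplexInt p))), Ω ≠ 0 → (δ ^ 2 = (NumberField.discr K : ℂ) ∨ δ ^ 2 = -(NumberField.discr K : ℂ)) → Literature.NumberTheory.EllipticCurves.IsKatzMeasure₂ ι v vbar ∅ κ₁ κ₂ γ₁⁻¹ γ₂⁻¹ 1 Ω δ ((Ωp : Literature.NumberTheory.EllipticCurves.unrIntegers p) : PadicComplex p) LK → Literature.NumberTheory.EllipticCurves.IsGreenbergLFunctionAnyRoot₂ ι v vbar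 κ₁ κ₂ γ₁⁻¹ γ₂⁻¹ f (NumberField.discr K).natAbs (NumberField.classNumber K) LK G → Literature.NumberTheory.EllipticCurves.IsGreenbergLFunctionAnyRoot₂ ι v vbar κ₁ κ₂ γ₁⁻¹ γ₂⁻¹ f' (NumberField.discr K).natAbs (NumberField.classNumber K) LK G' → ∀ J : ℤ_[p] →+* PadicComplexInt p, (∀ x : ℤ_[p], ((J x : PadicComplexInt p) : PadicComplex p) = ((x : ℚ_[p]) : PadicComplex p)) → ∃ s : PowerSeries (PadicComplexInt p), s ≠ 0 ∧ Ideal.span {PowerSeries.map (PowerSeries.C (R := PadicComplexInt p)) s} * ((WeierstrassCurve.XGr₂.charIdeal (W.baseChange K) p κ₁ κ₂ vbar γ₁ γ₂).map (Literature.NumberTheory.EllipticCurves.IwasawaAlgebra₂.toUnr₂ p J) * (WeierstrassCurve.XGr₂.charIdeal (W'.baseChange K) p κ₁ κ₂ vbar γ₁ γ₂).map (Literature.NumberTheory.EllipticCurves.IwasawaAlgebra₂.toUnr₂ p J)) ≤ Ideal.span {G * G'} :=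
  Summit.BirchSwinnertonDyer.BirchSwinnertonDyer.Theorems.SmallImageAcanchorGlueRatRatNotCMCoprime.canonicalNs_of_eulerSystemRatNotCMCoprime_of_acDivRatNotCMCoprime_noSurj
    stub_publishedInputs_ns.2.2 stub_ES2rat_ns stub_acDivRat_ns

/-- stub (v15-w2 = v13's `stub_muOneSign_ns_ge5` RESTORED = retired item stmt-BirchSwinnertonDyer-23117
`Theses.SignedLowerHalves.SmallImageOneSignUnitContent` VERBATIM; replaces v14's BOTH-signs `stub_muBothSigns_ns`): at every pair of
child L's domain with `5 ≤ p`, for the conductor-level newform `f`, SOME sign `ε₀` and some `L₀ ∈ Λ` with Pollack's parity-`ε₀`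
congruences and unit content — `min(μ(L_p⁺(E)), μ(L_p⁻(E))) = 0`.  OPEN class-wide at `p ≥ 5` but (a) a THEOREM granted Conjecture B⁰
`TeichSpanGenAll` with no image hypothesis (`LargeImageMuFloor.signedMuFloor_of_teichSpanGenAll_of_five_le` + Pollack-pair currency,
see the w2 helper `SignIdle.smallImageOneSignUnitContent_of_teichSpanGenAll`), (b) per pair ONE certificate of EITHER parity
(`SmallImageOrbitSumMu.exists_sign_hasUnitContent_of_norm_coeff_eq_one`), (c) at `p = 3` NOT NEEDED (input-free, `signedMuFloor_three`).
Why one sign suffices now: the sign of the integral Eisenstein half is idle on X7 (`SignDefect.X7.exists_kobayashiLowerDivisibility_iff_forall`,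
used in `SmallImageLowerHalfBothSigns_of` below, at the price of the joint package fact `stub_jointZeta_ns`).
[cite: PollackWeston2011, Thm. 4.1 (1), Rem. 4.2 (arXiv:0906.1741 p. 10)] [cite: Kobayashi2003, (3.4)–(3.6) (p. 7), Thm. 7.4 and its proof (p. 13)] -/
theorem stub_muOneSign_ns_ge5 : ∀ (W : WeierstrassCurve ℚ) [W.IsElliptic] [W.IsGloballyMinimal] (p : ℕ) [Fact p.Prime],
    5 ≤ p → ClassX7 W p → ¬ W.HasCM → W.frobeniusTrace p = 0 → ¬ Surj W p →
    ∀ [NeZero (W.conductorNorm ℤ)] (f : CuspForm (Gamma0 (W.conductorNorm ℤ)) 2),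
    IsNewformOf W f → ∃ (ε₀ : ℤˣ) (L₀ : IwasawaAlgebra p),
      IsSignedPAdicLFunction f p ε₀ L₀ ∧ HasUnitContent L₀ := by
  sorry

/-- `stub_muOneSign_ns_ge5` IS the retired route decl `SmallImageOneSignUnitContent` (item 23117), by `Iff.rfl` — so the planner can
re-itemise it by name.  No sorry of its own. -/
theorem stub_muOneSign_ns_ge5_iff :
    (∀ (W : WeierstrassCurve ℚ) [W.IsElliptic] [W.IsGloballyMinimal] (p : ℕ) [Fact p.Prime],
      5 ≤ p → ClassX7 W p → ¬ W.HasCM → W.frobeniusTrace p = 0 → ¬ Surj W p →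
      ∀ [NeZero (W.conductorNorm ℤ)] (f : CuspForm (Gamma0 (W.conductorNorm ℤ)) 2),
      IsNewformOf W f → ∃ (ε₀ : ℤˣ) (L₀ : IwasawaAlgebra p),
        IsSignedPAdicLFunction f p ε₀ L₀ ∧ HasUnitContent L₀) ↔
    Summit.BirchSwinnertonDyer.BirchSwinnertonDyer.Theses.SignedLowerHalves.SmallImageOneSignUnitContent :=
  Iff.rfl

/-- stub (v15-w2, NEW, HELD cite-only — ONE reviewed CONSTRUCTION fact of published theorems, ACCEPTED under `Literature/` without `_holds`,
net debt 0 for the route: it is already the conjunct `JointSignedColemanKatoZeta` of `stub_heldInputs` of crux 19001's line `commonzero_squeeze`):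
Kobayashi 2003 Thm. 5.2 iv) / 6.2 / 6.3 / 7.3 i) (7.21) and the proof of Thm. 7.4 with Kato Thm. 12.5/12.6 — the `+` and the `−` Coleman–Kato
packages at the trivial character sit on ONE zeta submodule `Z(T) ⊂ 𝐇¹(T)`.  It implies the one-sign package fact (3rd conjunct of the first
bundle of `stub_publishedInputs_ns`, `…_zeta_of_joint`), which v14 declared idle; the pen may fold this stub into that bundle (6 stubs) — kept
separate here so the vetted HELD text stays byte-identical. [cite: Kobayashi2003, Thm. 5.2 iv) (p. 9), Thm. 6.2/6.3 (p. 11), Thm. 7.3 i) (7.21), Thm. 7.4 and its proof (p. 13)]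
[cite: Kato2004Asterisque, Thm. 12.5/12.6 (p. 222)] -/
theorem stub_jointZeta_ns :
    Literature.NumberTheory.EllipticCurves.Kobayashi2003.thm62_63_73_signedColemanKato_zetaJoint := by
  sorry

/-- **v6–v10's seven-conjunct HELD bundle DERIVED from the v11/v13 re-cut** (five prints ∧ Mazur Cor. 4.1 [∧ BRR 2022 Thm. 1, unused here]) by the INPUTS desk's
`InputsPublishedNs.publishedInputs_ns_of_five_of_mazur` (p640631: the period-unit pair F5/F6 from Mazur via Skinner–Urban's
`realPeriodRat_eq_unit_mul_plusPeriod_of_mazur`). v14: the 5th conjunct (Coleman–Kato ζ) is IDLE under child L. No sorry of its own. -/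
theorem publishedInputs_of_stubs :
    Literature.NumberTheory.EllipticCurves.Kobayashi2003.thm41_signedCharIdeal_divisibility ∧
    Literature.NumberTheory.EllipticCurves.Kobayashi2003.thm12_signedSelmerDual_finite_torsion ∧
    Literature.NumberTheory.EllipticCurves.realPeriodRat_eq_unit_mul_plusPeriod ∧
    Literature.NumberTheory.EllipticCurves.realPeriodRat_eq_unit_mul_plusPeriod_three ∧
    Literature.NumberTheory.EllipticCurves.Kobayashi2003.thm62_63_73_signedColemanKato_zeta ∧
    Literature.NumberTheory.EllipticCurves.ModularForms.nonempty_modularParametrizationData ∧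
    Literature.NumberTheory.EllipticCurves.BurungaleCastellaSkinner2025.prop422_greenbergAnyRoot_hasUnitContent_minus :=
  Summit.BirchSwinnertonDyer.BirchSwinnertonDyer.Theorems.SignedLowerHalves.InputsPublishedNs.publishedInputs_ns_of_five_of_mazur
    stub_publishedInputs_ns.1 stub_publishedInputs_ns.2.1

/-- stub (PRE, cite-only — PREPRINT binders, arXiv:2409.01350v2): BSTW Thm 6.17 common Katz frame (GSF) and the
signed two-variable package (P1)–(P3). -/
theorem stub_preprintInputs_ns :
    Literature.NumberTheory.EllipticCurves.BurungaleSkinnerTianWan2024.thm617_exists_commonKatzFrame_isGreenbergLFunctionAnyRoot₂_supersingular_PRE ∧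
    Literature.NumberTheory.EllipticCurves.BurungaleSkinnerTianWan2024.props118_27_519_exists_signedTwoVariablePackage_supersingular_PRE := by
  sorry

/-- stub (v12; the `p = 3` Eisenstein half CUT TO ITS `p`-INVERTED λ-PART, both signs): on the crux's `p = 3` rows, for every
sign `ε`, every cyclotomic datum and every Pontryagin-dual datum `D` of `Sel^ε(E/ℚ_∞)`: `char X^ε = (g)` with `ϖ·L³_ε·h = 3^m·g` in
`ℚ₃⟦T⟧` for some `h`, `m` — VERBATIM crux 3's `LambdaLowerDivisibility W 3 ε` (line `horocycle_mu_floor`, item 19001) unfolded, with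
this crux's binders (`¬Surj`; the image binder is idle in every known engine).  OPEN / PRE-adjacent (the Eisenstein direction of the
rational signed IMC at `p = 3` off the square-free locus).  = retired item 23118 `SmallImageLambdaLowerAtThree` VERBATIM (already
both signs).  The integral half AT EVERY SIGN is DERIVED below (v14). -/
theorem stub_lambdaLowerThree_ns : ∀ (W : WeierstrassCurve ℚ) [W.IsElliptic] [W.IsGloballyMinimal] (p : ℕ) [Fact p.Prime],
    p = 3 → ClassX7 W p → ¬ W.HasCM → W.frobeniusTrace p = 0 → ¬ Surj W p →
    ∀ (ε : ℤˣ) (κ : ZpExtension ℚ p) (γ : Field.absoluteGaloisGroup ℚ),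
        κ.IsCyclotomic → κ.IsTopGenerator γ → IsCyclotomicVariable p γ →
      ∀ [NeZero (W.conductorNorm ℤ)] (f : CuspForm (Gamma0 (W.conductorNorm ℤ)) 2),
        IsNewformOf W f → ∀ (ϖ : ℚ), (ϖ : ℝ) * W.realPeriodRat = plusPeriod f →
      ∀ (Lplus Lminus : IwasawaAlgebra p), IsPollackPair f p Lplus Lminus →
      ∀ (D : SignedSelmerDualData W κ γ ε),
        ∃ (g h : IwasawaAlgebra p) (m : ℕ), D.charIdeal = Ideal.span {g} ∧
          iwasawaToPowerSeries p (PowerSeries.C ((p : ℤ_[p]) ^ m) * g) =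
            PowerSeries.C (ϖ : ℚ_[p]) * iwasawaToPowerSeries p (kobayashiL ε Lplus Lminus * h) := by
  sorry

/-- **`5 ≤ p`: the INTEGRAL Eisenstein half at ONE sign** from T3 (`canonical_ns_of_stubs`), the held / preprint inputs and the ONE-sign
rider, by the LEAD's descent `SmallImageAcnsCrux.kobayashiLowerDivisibility_of_package_of_signed_hasUnitContent_noSurj` (p621671: rational lower
divisibility from the package at every sign, made integral at the rider's sign `ε₀` because `p` is prime in `Λ`; Néron normalisation by `h5`).
The sign `ε₀` is chosen per CURVE (`LargeImageMuFloor.exists_sign_forall_isNewformOf`: the conductor-level newform is unique).  = v13's `5 ≤ p`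
branch verbatim in content.  No sorry of its own. [cite: Kobayashi2003, Conjecture (Main Conjecture) (p. 2), Thm. 1.2, Thm. 4.1 (p. 8)] [cite: GreenbergVatsal2000, p. 4 and §3 Remark 3.4] -/
theorem lowerOneSign_geFive_of_stubs : ∀ (W : WeierstrassCurve ℚ) [W.IsElliptic] [W.IsGloballyMinimal] (p : ℕ) [Fact p.Prime],
    5 ≤ p → ClassX7 W p → ¬ W.HasCM → W.frobeniusTrace p = 0 → ¬ Surj W p →
    ∃ ε₀ : ℤˣ, Summit.BirchSwinnertonDyer.Rank1Residual.Supersingular.KobayashiLowerDivisibility W p ε₀ := by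
  intro W _ _ p _ hp5 hX hCM hap hs
  obtain ⟨h41, h12, h5, -, -, hmodP, h422⟩ := publishedInputs_of_stubs
  obtain ⟨hGF, hpkg⟩ := stub_preprintInputs_ns
  obtain ⟨ε₀, hε₀⟩ := Summit.BirchSwinnertonDyer.BirchSwinnertonDyer.Theorems.LargeImageMuFloor.exists_sign_forall_isNewformOf
    (W := W) (fun ε f ↦ ∃ L₀ : IwasawaAlgebra p, IsSignedPAdicLFunction f p ε L₀ ∧ HasUnitContent L₀)
    (fun f hf ↦ stub_muOneSign_ns_ge5 W p hp5 hX hCM hap hs f hf)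
  exact ⟨ε₀, Summit.BirchSwinnertonDyer.BirchSwinnertonDyer.Theorems.SmallImageAcnsCrux.kobayashiLowerDivisibility_of_package_of_signed_hasUnitContent_noSurj
    h422 hpkg h41 h12 hmodP h5 hGF W p hp5 hX (canonical_ns_of_stubs ⟨h422, hpkg⟩ hmodP W p hp5 hX hCM hap hs) ε₀
    (fun f hf ↦ hε₀ f hf)⟩

/-- **`p = 3`: the INTEGRAL Eisenstein half at ONE sign, NO `μ`-rider** — the free sign `ε₀` with `μ(L₃^{ε₀}) = 0` is the tree's INPUT-FREE
`LargeImageMuFloor.signedMuFloor_three` (THEOREM B road: Vaserstein 1972 + Serre 1970 Prop. 12 + Pollack Prop. 6.18 integrally); then, exactly as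
v14, the `p`-inverted λ-part at `ε₀` (`stub_lambdaLowerThree_ns`) and the period unit (`HorocycleMuDoor.periodUnit_of_named_facts` from `h5`/`h3`)
through w2's door `HorocycleMuDoor.kobayashiLowerDivisibility_of_pInverted_of_hasUnitContent` (p647721).  No sorry of its own.
[cite: Kobayashi2003, Conjecture (p. 2)] [cite: PollackWeston2011, Thm. 4.1 (1), Rem. 4.2] [cite: Mazur1978, Cor. 4.1] [cite: Pollack2003, Prop. 6.9] -/
theorem lowerOneSign_three_of_stubs : ∀ (W : WeierstrassCurve ℚ) [W.IsElliptic] [W.IsGloballyMinimal] (p : ℕ) [Fact p.Prime],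
    p = 3 → ClassX7 W p → ¬ W.HasCM → W.frobeniusTrace p = 0 → ¬ Surj W p →
    ∃ ε₀ : ℤˣ, Summit.BirchSwinnertonDyer.Rank1Residual.Supersingular.KobayashiLowerDivisibility W p ε₀ := by
  intro W _ _ p _ hp3 hX hCM hap hs
  obtain ⟨-, -, h5, h3, -⟩ := publishedInputs_of_stubs
  have hp2 : p ≠ 2 := by omega
  obtain ⟨ε₀, hε₀⟩ :=
    Summit.BirchSwinnertonDyer.BirchSwinnertonDyer.Theorems.LargeImageMuFloor.signedMuFloor_three (W := W) p hp3 hX.1.1 hap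
  refine ⟨ε₀, Summit.BirchSwinnertonDyer.BirchSwinnertonDyer.Theorems.HorocycleMuDoor.kobayashiLowerDivisibility_of_pInverted_of_hasUnitContent
    W p ε₀ (stub_lambdaLowerThree_ns W p hp3 hX hCM hap hs ε₀) ?_
    (Summit.BirchSwinnertonDyer.BirchSwinnertonDyer.Theorems.HorocycleMuDoor.periodUnit_of_named_facts h5 h3 W p hp2 hX.1.1
      (hap ▸ dvd_zero _))⟩
  intro _ f hf Lplus Lminus hPP
  exact hε₀ f hf Lplus Lminus hPP

/-- **ONE sign at every odd `p`** (an odd prime is `3` or `≥ 5`). No sorry of its own. [cite: Kobayashi2003, Conjecture (Main Conjecture) (p. 2)] -/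
theorem lowerOneSign_of_stubs : ∀ (W : WeierstrassCurve ℚ) [W.IsElliptic] [W.IsGloballyMinimal] (p : ℕ) [Fact p.Prime],
    p ≠ 2 → ClassX7 W p → ¬ W.HasCM → W.frobeniusTrace p = 0 → ¬ Surj W p →
    ∃ ε₀ : ℤˣ, Summit.BirchSwinnertonDyer.Rank1Residual.Supersingular.KobayashiLowerDivisibility W p ε₀ := by
  intro W _ _ p hp hp2 hX hCM hap hs
  by_cases hp5 : 5 ≤ p
  · exact lowerOneSign_geFive_of_stubs W p hp5 hX hCM hap hs
  · have h2 := hp.out.two_le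
    have hp3 : p = 3 := by
      interval_cases p
      · exact absurd rfl hp2
      · rfl
      · exact absurd hp.out (by decide)
    exact lowerOneSign_three_of_stubs W p hp3 hX hCM hap hs

/-- composition = THE SKELETON (v15-w2): child L `SmallImageLowerHalfBothSigns` BY NAME from the seven stubs — the integral Eisenstein half at
ONE sign (`lowerOneSign_of_stubs`), then THE SIGN IS IDLE on class X7 at an odd `p` with `a_p = 0`:
`SignDefect.X7.exists_kobayashiLowerDivisibility_iff_forall` (granted Kobayashi Thm. 1.2 `h12`, the period facts `h5`/`h3` — conjuncts 2–4 of
`publishedInputs_of_stubs` — and the JOINT package `stub_jointZeta_ns`; Tate-module instances discharged in the kernel there).  No sorry of its own.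
[cite: Kobayashi2003, Conjecture (Main Conjecture) (p. 2), Thm. 7.4 and its proof (p. 13)] [cite: Kato2004Asterisque, Conj. 12.10 (p. 224)] -/
theorem SmallImageLowerHalfBothSigns_of :
    Summit.BirchSwinnertonDyer.BirchSwinnertonDyer.Theses.SignedLowerHalves.SmallImageLowerHalfBothSigns := by
  intro W _ _ p hp hp2 hX hCM hap hs ε
  obtain ⟨-, h12, h5, h3, -⟩ := publishedInputs_of_stubs
  exact (Summit.BirchSwinnertonDyer.BirchSwinnertonDyer.Theorems.SignDefect.X7.exists_kobayashiLowerDivisibility_iff_forall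
    W p h12 h5 h3 stub_jointZeta_ns hp2 hX hap).mp (lowerOneSign_of_stubs W p hp2 hX hCM hap hs) ε

end Summit.BirchSwinnertonDyer.BirchSwinnertonDyer.Cruxes.SmallImageLowerHalfBothSigns.BirthAcns

end
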